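import Literature.NumberTheory.Automorphic.TwistedCoinvariantStalks
import Literature.NumberTheory.Automorphic.AdditiveCharacterDuality
import Literature.NumberTheory.Automorphic.ParabolicInductionSupercuspidalProofs
import HarnessLib

/-!
# The stalk datum of `F^m`: lattices, the pairing `ψ(b · x)` and their duality

Let `F` be a non-archimedean local field (`IsNonarchimedeanLocalField F`), `ψ : F → 𝕊` a
non-trivial continuous additive character and `m : ℕ`. This file builds the `StalkDatum`
(`Literature.NumberTheory.Automorphic.TwistedCoinvariantStalks`) of the additive group `F^m` in
duality with itself through the pairing `χ b x = ψ(∑ᵢ bᵢ xᵢ)` (Bump 1997, §4.4, p. 462: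
"`F` is isomorphic to its own dual group … `a ∈ F` corresponds to the character
`ψ_a(x) = ψ(ax)`"; Exercise 3.1.1), and deduces the **existence of a non-zero twisted costalk**
for smooth actions of `F^m` (`exists_notMem_sup_span_pi`), the form in which the abstract
theorem `StalkDatum.exists_notMem_sup_twistedSpan` is used for the column groups of `U_n`.

* `valLattice m γ = {x : Fin m → F | ∀ i, |xᵢ| ≤ γ}` — the coordinate lattices; open (for
  `γ ≠ 0`), compact, a neighbourhood basis of `0` and exhaustive along `γ = x₀^{-k}`, `k ∈ ℤ`
  (`0 < x₀ < 1`).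
* `addCharPairing ψ b x = ψ(∑ bᵢ xᵢ)` (as a complex number) — bi-additive, of modulus one.
* `annLattice ψ m γ` — the annihilator `{b | ψ(b · x) = 1 for all x ∈ valLattice m γ}`; it is
  **open** (`ψ = 1` near `0`, `AddCharDuality.exists_forall_lt_apply_eq_one`), **compact**
  (`ψ ≠ 1`: `b ↦ bᵢ` is bounded on it) and **separates**: for `x ∉ valLattice m γ` some
  `b ∈ annLattice ψ m γ` has `ψ(b · x) ≠ 1` (rescale `ψ` to level one,
  `AddCharDuality.exists_mulShift_level_one`, and test against one coordinate).
* `piStalkDatum` — the resulting `StalkDatum ℂ (Fin m → F) (Fin m → F)`, and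
  `exists_notMem_sup_span_pi` — for an additive, smooth (stabilisers are neighbourhoods of `0`)
  action `ρ` of `F^m` on a complex vector space, a `ρ`-stable subspace `W` and `v ∉ W`, some
  `b` has `v ∉ W + ⟨ρ(x) u - ψ(b · x) u⟩` (Bump 1997, Prop. 4.4.5 and the proof of Thm. 4.4.3,
  for `m = 1`; Bernstein–Zelevinsky 1976, §5, existence of derivatives, in general).

All statements are proved; no named facts, no instances, no `sorry`.

## References

* D. Bump, *Automorphic Forms and Representations* (1997), §4.4, pp. 460–466 of the held copy,
  and Exercise 3.1.1 (p. 266). [Bump1997]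
* I. N. Bernstein, A. V. Zelevinsky, Russian Math. Surveys 31:3 (1976), §1, §5.
  [BernsteinZelevinsky1976]
-/

noncomputable section

open scoped Topology
open ValuativeRel

namespace Literature.NumberTheory.Automorphic

/-! ### Coordinate lattices in `F^m` -/

section Lattice

variable {F : Type*} [Field F] [ValuativeRel F] (m : ℕ)

/-- The **coordinate lattice** `{x : Fin m → F | ∀ i, |xᵢ| ≤ γ}` of radius `γ` (for
`γ = |ϖ|^k` this is `(𝔭^k)^m`). [folklore] -/
def valLattice (γ : ValueGroupWithZero F) : AddSubgroup (Fin m → F) where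
  carrier := {x | ∀ i, valuation F (x i) ≤ γ}
  zero_mem' i := by simp
  add_mem' {x y} hx hy i := by
    rw [Pi.add_apply]
    exact Valuation.map_add_le _ (hx i) (hy i)
  neg_mem' {x} hx i := by
    rw [Pi.neg_apply, Valuation.map_neg]
    exact hx i

variable {m}

/-- Membership in a coordinate lattice. [folklore] -/
@[simp] theorem mem_valLattice_iff {γ : ValueGroupWithZero F} {x : Fin m → F} :
    x ∈ valLattice m γ ↔ ∀ i, valuation F (x i) ≤ γ := Iff.rfl

/-- Coordinate lattices increase with the radius. [folklore] -/
theorem valLattice_mono {γ δ : ValueGroupWithZero F} (h : γ ≤ δ) :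
    valLattice m γ ≤ valLattice m δ := fun _ hx i => (hx i).trans h

/-- The coordinate lattice is the product of the closed balls. [folklore] -/
theorem coe_valLattice (γ : ValueGroupWithZero F) :
    (valLattice m γ : Set (Fin m → F)) = Set.univ.pi fun _ => {y : F | valuation F y ≤ γ} := by
  ext x
  simp [valLattice]

variable [TopologicalSpace F] [IsNonarchimedeanLocalField F]

/-- Coordinate lattices are compact. [folklore] -/
theorem isCompact_valLattice (γ : ValueGroupWithZero F) :
    IsCompact (valLattice m γ : Set (Fin m → F)) := by
  rw [coe_valLattice]
  exact isCompact_univ_pi fun _ => IsNonarchimedeanLocalField.isCompact_closedBall F γ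

/-- Closed balls of non-zero radius are neighbourhoods of `0` in `F`. [folklore] -/
theorem setOf_valuation_le_mem_nhds_zero {γ : ValueGroupWithZero F} (hγ : γ ≠ 0) :
    {y : F | valuation F y ≤ γ} ∈ 𝓝 (0 : F) := by
  refine Filter.mem_of_superset ((IsValuativeTopology.mem_nhds_zero_iff _).2
    ⟨Units.mk0 γ hγ, subset_rfl⟩) fun y hy => ?_
  exact le_of_lt (by simpa using hy)

/-- Coordinate lattices of non-zero radius are neighbourhoods of `0`. [folklore] -/
theorem valLattice_mem_nhds_zero {γ : ValueGroupWithZero F} (hγ : γ ≠ 0) :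
    (valLattice m γ : Set (Fin m → F)) ∈ 𝓝 (0 : Fin m → F) := by
  rw [coe_valLattice]
  exact set_pi_mem_nhds Set.finite_univ fun i _ => setOf_valuation_le_mem_nhds_zero hγ

/-- Coordinate lattices of non-zero radius are open. [folklore] -/
theorem isOpen_valLattice {γ : ValueGroupWithZero F} (hγ : γ ≠ 0) :
    IsOpen (valLattice m γ : Set (Fin m → F)) :=
  AddSubgroup.isOpen_of_mem_nhds _ (by simpa using valLattice_mem_nhds_zero (m := m) hγ)

/-- **The coordinate lattices form a neighbourhood basis of `0`**: every neighbourhood of `0`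
in `F^m` contains a coordinate lattice of non-zero radius. [folklore] -/
theorem exists_valLattice_subset {U : Set (Fin m → F)} (hU : U ∈ 𝓝 (0 : Fin m → F)) :
    ∃ γ : ValueGroupWithZero F, γ ≠ 0 ∧ (valLattice m γ : Set (Fin m → F)) ⊆ U := by
  rw [nhds_pi, Filter.mem_pi] at hU
  obtain ⟨I, -, t, ht, hsub⟩ := hU
  have hball : ∀ i, ∃ γ : (ValueGroupWithZero F)ˣ, {y : F | valuation F y < γ} ⊆ t i := fun i =>
    (IsValuativeTopology.mem_nhds_zero_iff _).1 (ht i)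
  choose γ hγ using hball
  obtain ⟨z, hz0, hz1⟩ := Valuation.IsNontrivial.exists_lt_one (v := valuation F)
  have hz : valuation F z ≠ 0 := (Valuation.ne_zero_iff _).2 hz0
  -- radii `δ i < γ i`, and a common non-zero lower bound
  set δ : Fin m → ValueGroupWithZero F := fun i => (γ i : ValueGroupWithZero F) * valuation F z
  have hδ0 : ∀ i, δ i ≠ 0 := fun i => mul_ne_zero (γ i).ne_zero hz
  have hδlt : ∀ i, δ i < γ i := fun i =>
    mul_lt_of_lt_one_right (zero_lt_iff.2 (γ i).ne_zero) hz1
  obtain ⟨δ₀, hδ₀0, hδ₀⟩ : ∃ δ₀ : ValueGroupWithZero F, δ₀ ≠ 0 ∧ ∀ i, δ₀ ≤ δ i := by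
    rcases isEmpty_or_nonempty (Fin m) with hm | hm
    · exact ⟨1, one_ne_zero, fun i => (hm.false i).elim⟩
    · obtain ⟨i₀, hi₀⟩ := Finite.exists_min δ
      exact ⟨δ i₀, hδ0 i₀, hi₀⟩
  refine ⟨δ₀, hδ₀0, fun x hx => hsub fun i _ => hγ i ?_⟩
  exact lt_of_le_of_lt ((hx i).trans (hδ₀ i)) (hδlt i)

/-- The quotient of a coordinate lattice by (the trace of) another is finite: a compact
group modulo an open subgroup. [folklore] -/
theorem finite_valLattice_quotient (γ : ValueGroupWithZero F) {δ : ValueGroupWithZero F}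
    (hδ : δ ≠ 0) :
    Finite (valLattice m γ ⧸ (valLattice m δ).addSubgroupOf (valLattice m γ)) := by
  haveI : CompactSpace (valLattice m γ) := isCompact_iff_compactSpace.mp (isCompact_valLattice γ)
  exact AddSubgroup.quotient_finite_of_isOpen _
    (AddSubgroup.addSubgroupOf_isOpen _ _ (isOpen_valLattice hδ))

end Lattice

/-! ### The pairing `ψ(b · x)` -/

section Pairing

variable {F : Type*} [Field F] {m : ℕ}

/-- The **standard pairing** of `F^m` with itself through `ψ`:
`(b, x) ↦ ψ(∑ᵢ bᵢ xᵢ) ∈ 𝕊 ⊆ ℂ` (Bump 1997, §4.4, p. 462, `ψ_a(x) = ψ(a x)` for `m = 1`). [folklore] -/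
def addCharPairing (ψ : AddChar F Circle) (b x : Fin m → F) : ℂ :=
  ψ (∑ i, b i * x i)

/-- Unfolding of `addCharPairing`. [folklore] -/
theorem addCharPairing_apply (ψ : AddChar F Circle) (b x : Fin m → F) :
    addCharPairing ψ b x = ψ (∑ i, b i * x i) := rfl

/-- The pairing is additive in `b`. [folklore] -/
theorem addCharPairing_add_left (ψ : AddChar F Circle) (b b' x : Fin m → F) :
    addCharPairing ψ (b + b') x = addCharPairing ψ b x * addCharPairing ψ b' x := by
  simp only [addCharPairing, Pi.add_apply, add_mul, Finset.sum_add_distrib, AddChar.map_add_eq_mul,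
    Circle.coe_mul]

/-- The pairing is additive in `x`. [folklore] -/
theorem addCharPairing_add_right (ψ : AddChar F Circle) (b x y : Fin m → F) :
    addCharPairing ψ b (x + y) = addCharPairing ψ b x * addCharPairing ψ b y := by
  simp only [addCharPairing, Pi.add_apply, mul_add, Finset.sum_add_distrib, AddChar.map_add_eq_mul,
    Circle.coe_mul]

/-- The pairing takes non-zero values (of modulus one). [folklore] -/
theorem addCharPairing_ne_zero (ψ : AddChar F Circle) (b x : Fin m → F) : addCharPairing ψ b x ≠ 0 :=
  Circle.coe_ne_zero _

/-- The pairing against a vector supported on one coordinate. [folklore] -/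
theorem addCharPairing_single_left (ψ : AddChar F Circle) (i : Fin m) (c : F) (x : Fin m → F) :
    addCharPairing ψ (Pi.single i c) x = ψ (c * x i) := by
  rw [addCharPairing_apply, Finset.sum_eq_single i]
  · rw [Pi.single_eq_same]
  · intro j _ hj
    rw [Pi.single_eq_of_ne hj, zero_mul]
  · exact fun h => absurd (Finset.mem_univ i) h

/-- The pairing against a vector supported on one coordinate (right). [folklore] -/
theorem addCharPairing_single_right (ψ : AddChar F Circle) (b : Fin m → F) (i : Fin m) (c : F) :
    addCharPairing ψ b (Pi.single i c) = ψ (b i * c) := by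
  rw [addCharPairing_apply, Finset.sum_eq_single i]
  · rw [Pi.single_eq_same]
  · intro j _ hj
    rw [Pi.single_eq_of_ne hj, mul_zero]
  · exact fun h => absurd (Finset.mem_univ i) h

end Pairing

/-! ### Annihilator lattices and their duality with the coordinate lattices -/

section Annihilator

variable {F : Type*} [Field F] [ValuativeRel F] (ψ : AddChar F Circle) (m : ℕ)

/-- The **annihilator** of the coordinate lattice of radius `γ` under the pairing:
`{b | ψ(b · x) = 1 for all x with |xᵢ| ≤ γ}` (for `m = 1` and `ψ` of conductor `𝔭^d` this is
`𝔭^{d-k}` when `γ = |ϖ|^k`; Bump 1997, §4.4, p. 463). [folklore] -/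
def annLattice (γ : ValueGroupWithZero F) : AddSubgroup (Fin m → F) where
  carrier := {b | ∀ x ∈ valLattice m γ, addCharPairing ψ b x = 1}
  zero_mem' x _ := by simp [addCharPairing]
  add_mem' {b b'} hb hb' x hx := by rw [addCharPairing_add_left, hb x hx, hb' x hx, one_mul]
  neg_mem' {b} hb x hx := by
    have h := addCharPairing_add_left ψ (-b) b x
    rw [neg_add_cancel, hb x hx] at h
    have h0 : addCharPairing ψ 0 x = 1 := by simp [addCharPairing]
    rw [h0] at h
    exact (eq_inv_of_mul_eq_one_left h.symm).trans inv_one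

variable {ψ m}

/-- Membership in the annihilator lattice. [folklore] -/
theorem mem_annLattice_iff {γ : ValueGroupWithZero F} {b : Fin m → F} :
    b ∈ annLattice ψ m γ ↔ ∀ x ∈ valLattice m γ, addCharPairing ψ b x = 1 := Iff.rfl

variable [TopologicalSpace F] [IsNonarchimedeanLocalField F]

/-- **The annihilator is open**: a continuous `ψ` is trivial on a ball `{|y| < η}`, so every `b`
with small coordinates pairs trivially with the lattice. [folklore] -/
theorem isOpen_annLattice (hψ : Continuous ψ) (γ : ValueGroupWithZero F) :
    IsOpen (annLattice ψ m γ : Set (Fin m → F)) := by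
  obtain ⟨η, hη⟩ := AddCharDuality.exists_forall_lt_apply_eq_one hψ
  obtain ⟨z, hz0, hz1⟩ := Valuation.IsNontrivial.exists_lt_one (v := valuation F)
  -- radius `δ` with `δ γ < η`
  obtain ⟨δ, hδ0, hδ⟩ : ∃ δ : ValueGroupWithZero F, δ ≠ 0 ∧ δ * γ < η := by
    by_cases hγ : γ = 0
    · exact ⟨1, one_ne_zero, by rw [hγ, mul_zero]; exact zero_lt_iff.2 η.ne_zero⟩
    · refine ⟨η * γ⁻¹ * valuation F z, ?_, ?_⟩
      · exact mul_ne_zero (mul_ne_zero η.ne_zero (inv_ne_zero hγ))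
          ((Valuation.ne_zero_iff _).2 hz0)
      · rw [mul_assoc, mul_comm (valuation F z), ← mul_assoc, mul_assoc (η : ValueGroupWithZero F),
          inv_mul_cancel₀ hγ, mul_one]
        exact mul_lt_of_lt_one_right (zero_lt_iff.2 η.ne_zero) hz1
  refine AddSubgroup.isOpen_of_mem_nhds _ (Filter.mem_of_superset (valLattice_mem_nhds_zero hδ0)
    fun b hb x hx => ?_)
  rw [addCharPairing_apply, hη _ ?_, Circle.coe_one]
  refine lt_of_le_of_lt (Valuation.map_sum_le _ fun i _ => ?_) hδ
  rw [Valuation.map_mul]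
  exact mul_le_mul' (hb i) (hx i)

omit [TopologicalSpace F] [IsNonarchimedeanLocalField F] in
/-- **The annihilator is bounded**: if `ψ y₀ ≠ 1`, `γ ≠ 0` and `b` annihilates the lattice of
radius `γ`, then `|bᵢ| ≤ |y₀| γ⁻¹` for all `i` (otherwise test against `(y₀ / bᵢ) eᵢ`). [folklore] -/
theorem valuation_le_of_mem_annLattice {y₀ : F} (hy₀ : ψ y₀ ≠ 1) {γ : ValueGroupWithZero F}
    (hγ : γ ≠ 0) {b : Fin m → F} (hb : b ∈ annLattice ψ m γ) (i : Fin m) :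
    valuation F (b i) ≤ valuation F y₀ * γ⁻¹ := by
  by_contra hlt
  rw [not_le] at hlt
  have hbi : b i ≠ 0 := by
    rintro h
    rw [h, Valuation.map_zero] at hlt
    exact not_lt_of_ge zero_le hlt
  have hbpos : 0 < valuation F (b i) := zero_lt_iff.2 ((Valuation.ne_zero_iff _).2 hbi)
  have h1 : valuation F y₀ < valuation F (b i) * γ := (mul_inv_lt_iff₀ (zero_lt_iff.2 hγ)).1 hlt
  have h2 : valuation F y₀ / valuation F (b i) < γ := by
    rw [div_lt_iff₀ hbpos, mul_comm]
    exact h1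
  have hmem : Pi.single i (y₀ / b i) ∈ valLattice m γ := by
    intro j
    by_cases hj : j = i
    · subst hj
      rw [Pi.single_eq_same, Valuation.map_div]
      exact h2.le
    · rw [Pi.single_eq_of_ne hj, Valuation.map_zero]
      exact zero_le
  have := hb _ hmem
  rw [addCharPairing_single_right, mul_div_cancel₀ _ hbi] at this
  exact hy₀ (Circle.coe_eq_one.1 this)

/-- **The annihilator is compact** (closed and bounded, for non-trivial continuous `ψ` and
`γ ≠ 0`). [folklore] -/
theorem isCompact_annLattice (hψ : ψ.IsContinuousNontrivial) {γ : ValueGroupWithZero F}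
    (hγ : γ ≠ 0) : IsCompact (annLattice ψ m γ : Set (Fin m → F)) := by
  obtain ⟨y₀, hy₀⟩ : ∃ y₀, ψ y₀ ≠ 1 := AddChar.ne_zero_iff.1 hψ.2
  have hclosed : IsClosed (annLattice ψ m γ : Set (Fin m → F)) := by
    have : (annLattice ψ m γ : Set (Fin m → F)) =
        ⋂ x ∈ valLattice m γ, {b | addCharPairing ψ b x = 1} := by
      ext b; simp [mem_annLattice_iff]
    rw [this]
    refine isClosed_biInter fun x _ => isClosed_eq ?_ continuous_const
    exact continuous_subtype_val.comp <| hψ.1.comp <|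
      continuous_finsetSum _ fun i _ => (continuous_apply i).mul continuous_const
  refine (isCompact_valLattice (valuation F y₀ * γ⁻¹)).of_isClosed_subset hclosed fun b hb i => ?_
  exact valuation_le_of_mem_annLattice hy₀ hγ hb i

/-- An element of `𝒪[F]` of valuation `< 1` lies in the maximal ideal. [folklore] -/
theorem integer_mem_maximalIdeal_of_valuation_lt_one {y : 𝒪[F]} (hy : valuation F (y : F) < 1) :
    y ∈ 𝓂[F] := by
  rw [IsLocalRing.mem_maximalIdeal, mem_nonunits_iff,
    (Valuation.integer.integers (valuation F)).isUnit_iff_valuation_eq_one]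
  exact hy.ne

/-- **Separation (biduality of lattices).** If `x ∉ valLattice m γ` (`γ ≠ 0`) then some `b` in
the annihilator of that lattice pairs non-trivially with `x`: rescale `ψ` to level one
(`ψ(t ·)` trivial on `𝓂` but `ψ(t y₁) ≠ 1` for some `y₁ ∈ 𝒪`, Bump 1997, Exercise 3.1.1 (b)) and
take `b = (t y₁ / xᵢ) eᵢ` for a coordinate `i` with `|xᵢ| > γ`.
[cite: Bump1997, Exercise 3.1.1 (b) (PDF p. 266)] -/
theorem exists_mem_annLattice_addCharPairing_ne_one (hψ : ψ.IsContinuousNontrivial)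
    {γ : ValueGroupWithZero F} {x : Fin m → F} (hx : x ∉ valLattice m γ) :
    ∃ b ∈ annLattice ψ m γ, addCharPairing ψ b x ≠ 1 := by
  obtain ⟨i, hi⟩ : ∃ i, γ < valuation F (x i) := by
    by_contra h
    push Not at h
    exact hx h
  obtain ⟨ϖ, hϖ⟩ := IsDiscreteValuationRing.exists_irreducible 𝒪[F]
  obtain ⟨t, -, ht1, y₁, hy₁⟩ := AddCharDuality.exists_mulShift_level_one hϖ hψ
  simp only [AddChar.mulShift_apply] at ht1 hy₁
  have hxi : x i ≠ 0 := by
    rintro h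
    rw [h, Valuation.map_zero] at hi
    exact not_lt_of_ge zero_le hi
  refine ⟨Pi.single i (t * y₁ / x i), fun x' hx' => ?_, ?_⟩
  · rw [addCharPairing_single_left]
    have hval : valuation F ((y₁ : F) * x' i / x i) < 1 := by
      rw [Valuation.map_div, Valuation.map_mul, div_lt_one₀ (lt_of_le_of_lt zero_le hi)]
      calc valuation F (y₁ : F) * valuation F (x' i) ≤ 1 * γ :=
            mul_le_mul' ((Valuation.mem_integer_iff _ _).1 y₁.2) (hx' i)
        _ = γ := one_mul γ
        _ < valuation F (x i) := hi
    have hint : (y₁ : F) * x' i / x i ∈ 𝒪[F] := (Valuation.mem_integer_iff _ _).2 hval.le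
    have h1 := ht1 ⟨_, hint⟩ (integer_mem_maximalIdeal_of_valuation_lt_one hval)
    have heq : t * (y₁ : F) / x i * x' i = t * ((⟨_, hint⟩ : 𝒪[F]) : F) := by
      push_cast
      ring
    rw [heq, h1, Circle.coe_one]
  · rw [addCharPairing_single_left, div_mul_cancel₀ _ hxi]
    exact fun h => hy₁ (Circle.coe_eq_one.1 h)

end Annihilator

/-! ### The stalk datum of `F^m` and the existence of a non-zero twisted costalk -/

section Datum

variable {F : Type*} [Field F] [ValuativeRel F] [TopologicalSpace F] [IsNonarchimedeanLocalField F]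
  (ψ : AddChar F Circle) (m : ℕ)

/-- **The stalk datum of `F^m`.** For a non-trivial continuous `ψ` and `0 < x₀ < 1` in the value
group: characters `χ b x = ψ(∑ bᵢ xᵢ)`, lattices `L k = valLattice m (x₀^{-k})` (`k ∈ ℤ`,
increasing and exhaustive), annihilators `D k = annLattice ψ m (x₀^{-k})`; the axioms of
`StalkDatum` are the lemmas of this file. (Bump 1997, §4.4, pp. 462–464, self-duality of `F`.)
[folklore] -/
def piStalkDatum (hψ : ψ.IsContinuousNontrivial) (x₀ : ValueGroupWithZero F) (hx₀ : x₀ ≠ 0)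
    (hx₁ : x₀ < 1) : StalkDatum ℂ (Fin m → F) (Fin m → F) where
  χ := addCharPairing ψ
  L k := valLattice m (x₀ ^ (-k))
  D k := annLattice ψ m (x₀ ^ (-k))
  χ_add_left := addCharPairing_add_left ψ
  χ_add_right := addCharPairing_add_right ψ
  χ_ne_zero := addCharPairing_ne_zero ψ
  mono k k' hk := valLattice_mono
    (zpow_le_zpow_right_of_le_one₀ (zero_lt_iff.2 hx₀) hx₁.le (neg_le_neg hk))
  exhaust x := by
    have h : ∀ i, ∃ d₀ : ℕ, ∀ d : ℕ, d₀ ≤ d → valuation F (x i) < x₀ ^ (-(d : ℤ)) := fun i =>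
      exists_forall_lt_zpow_neg hx₀ hx₁ _
    choose d hd using h
    refine ⟨((∑ i, d i : ℕ) : ℤ), fun i => (hd i _ ?_).le⟩
    exact Finset.single_le_sum (fun j _ => Nat.zero_le (d j)) (Finset.mem_univ i)
  finite_quotient r s := finite_valLattice_quotient _ (zpow_ne_zero _ hx₀)
  mem_D_iff s b := Iff.rfl
  isCompact_D k := isCompact_annLattice hψ (zpow_ne_zero _ hx₀)
  isOpen_D k := isOpen_annLattice hψ.1 _
  sep k x hx := exists_mem_annLattice_addCharPairing_ne_one hψ hx

variable {ψ m}

/-- **Existence of a non-zero twisted costalk for smooth actions of `F^m`.** Let `ψ` be a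
non-trivial continuous additive character of the non-archimedean local field `F`, and let `ρ`
be an additive action of `F^m` on a complex vector space `V` (`ρ (x + y) = ρ x ∘ ρ y`) which is
smooth: the stabiliser of every vector is a neighbourhood of `0`. If `W` is a `ρ`-stable
subspace and `v ∉ W`, then for some `b ∈ F^m`,
`v ∉ W + ⟨ρ(x) u - ψ(∑ bᵢ xᵢ) u : x ∈ F^m, u ∈ V⟩`: the `ψ_b`-twisted coinvariants of `V / W`
are non-zero. For `m = 1` and `W = 0` this is "a non-zero smooth `N(F)`-module has a non-zero
stalk `𝒮(V)_a ≅ J_{ψ_a}(V)`" (Bump 1997, Props. 4.3.12–4.3.13 and 4.4.5, the mechanism of the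
proof of Thm. 4.4.3); for `F^{n-1} ≅ V_n ≤ P_n` it is the non-vanishing of some derivative
(Bernstein–Zelevinsky 1976, §5). [cite: Bump1997, Proposition 4.4.5 and Theorem 4.4.3 (PDF p. 464)] -/
theorem exists_notMem_sup_span_pi (hψ : ψ.IsContinuousNontrivial) {V : Type*} [AddCommGroup V]
    [Module ℂ V] (ρ : (Fin m → F) → V →ₗ[ℂ] V) (hρ : ∀ x y, ρ (x + y) = ρ x ∘ₗ ρ y)
    (hsm : ∀ v : V, {x | ρ x v = v} ∈ 𝓝 (0 : Fin m → F)) {W : Submodule ℂ V}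
    (hW : ∀ x, ∀ w ∈ W, ρ x w ∈ W) {v : V} (hv : v ∉ W) :
    ∃ b : Fin m → F, v ∉ W ⊔ Submodule.span ℂ
      {w | ∃ x u, w = ρ x u - (ψ (∑ i, b i * x i) : ℂ) • u} := by
  obtain ⟨z, hz0, hz1⟩ := Valuation.IsNontrivial.exists_lt_one (v := valuation F)
  have hx₀ : valuation F z ≠ 0 := (Valuation.ne_zero_iff _).2 hz0
  set 𝒟 := piStalkDatum ψ m hψ (valuation F z) hx₀ hz1 with h𝒟
  have hsm' : ∀ v : V, ∃ s, ∀ x ∈ 𝒟.L s, ρ x v = v := by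
    intro u
    obtain ⟨γ, hγ0, hγ⟩ := exists_valLattice_subset (hsm u)
    obtain ⟨d, hd⟩ := exists_pow_mul_le hx₀ hz1 1 hγ0
    refine ⟨-(d : ℤ), fun x hx => hγ (valLattice_mono ?_ hx)⟩
    rw [neg_neg, zpow_natCast]
    simpa using hd
  exact 𝒟.exists_notMem_sup_twistedSpan ρ hρ hsm' hW hv

end Datum

end Literature.NumberTheory.Automorphic
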